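import Literature.NumberTheory.LFunctions.ZetaZeroLinearRelations
import Mathlib.Analysis.InnerProductSpace.GramSchmidtOrtho
import HarnessLib

/-!
# Linear relations of zeta zeros: the Gram–Schmidt certificate of `{N_γ}`-independence (Best–Trudgian 2015, §3 Lemma 3 and Theorem 3)

Topic `Literature/NumberTheory/LFunctions` (sub-namespace `BestTrudgian`). Second file of the
vendoring of the lattice half of

* D. G. Best, T. S. Trudgian, *Linear relations of zeroes of the zeta-function*, Math. Comp. 84
  (2015), 2047–2058; arXiv:1209.3843 [BestTrudgian2015],

after `ZetaZeroLinearRelations.lean` (Definition 1 `NIndependent`, the lattice `L(K; S)`,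
Definitions 3–4, Lemmas 1–2). Proved here:

* `BestTrudgian.exists_norm_gramSchmidt_le` — **Lemma 3**: a non-zero integer combination of
  `b₁, …, bₘ` is at least as long as some Gram–Schmidt vector `bₖ*` (so `|x|² ≥ min |bᵢ*|²`);
  `BestTrudgian.le_norm_sq_of_mem_span` (the form used below).
* `BestTrudgian.nIndependent_of_gramSchmidt_bounds` — **Theorem 3**: if some family generating
  `L₀ = L(K; Γ')` has all `|bᵢ*|² ≥ (n²+n)N² + (2n+2)N + 2` and, for every
  `γ_t ∈ (Γ ∩ [0,T]) ∖ Γ'`, some family generating `L_t = L(K; Γ' ∪ {γ_t})` has all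
  `|β_{t,i}*|² ≥ (n²+n)N² + 2nN + 2`, then the elements of `Γ'` are `{N_γ}`-independent in
  `Γ ∩ [0, T]` (all `N_γ = N`).

## Deviations from the printed text

* Lemma 3 is printed for "a lattice of dimension `m`" with basis `{bᵢ}`; linear independence is not
  needed for the inequality and is not assumed.
* Theorem 3 asks for bounds on the Gram–Schmidt vectors of *a* basis of each lattice (the paper
  takes LLL-reduced ones; §3.1: "we do not care which basis of the lattice we choose"); we only ask
  that the family *generate* the lattice over `ℤ`, which is all the proof uses. Lemma 2 enters in
  the form actually established (coefficient of `γ_t` equal to `−1`), see the first file.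

## What is NOT here

The LLL reduction producing such bases, and the instance of Theorem 4 (`K = 10^9000`, `n = 500`
heaviest zeros below `T = γ₂₀₀₁ − ε`, `N_γ = 4976`), a computation recorded as a named fact in
`BestTrudgian2015.lean`.

## References

* [BestTrudgian2015] §3.1, Lemma 3 and Theorem 3 (with Lemmas 1–2 and Definition 1), read from
  arXiv:1209.3843.
* M. R. Bremner, *Lattice Basis Reduction*, CRC Press 2011 (the source's reference for Lemma 3;
  cited through [BestTrudgian2015]).
-/

noncomputable section

open Finset InnerProductSpace
open scoped RealInnerProductSpace

namespace Literature.NumberTheory.LFunctions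

namespace BestTrudgian

variable {n : ℕ}

/-! ## Lemma 3: Gram–Schmidt lengths bound lattice vectors from below -/

section GramSchmidt

variable {E : Type*} [NormedAddCommGroup E] [InnerProductSpace ℝ E]

/-- `⟪bₖ*, bₖ⟫ = ‖bₖ*‖²`: `bₖ` differs from `bₖ*` by a combination of the earlier `bᵢ*`, which are
orthogonal to `bₖ*`. [folklore] -/
theorem inner_gramSchmidt_self {ι : Type*} [LinearOrder ι] [LocallyFiniteOrderBot ι]
    [WellFoundedLT ι] (f : ι → E) (k : ι) :
    ⟪gramSchmidt ℝ f k, f k⟫_ℝ = ‖gramSchmidt ℝ f k‖ ^ 2 := by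
  conv_lhs => rw [gramSchmidt_def'' ℝ f k]
  rw [inner_add_right, real_inner_self_eq_norm_sq, inner_sum, add_eq_left]
  refine Finset.sum_eq_zero fun i hi ↦ ?_
  rw [real_inner_smul_right, gramSchmidt_orthogonal ℝ f (Finset.mem_Iio.mp hi).ne', mul_zero]

/-- **Best–Trudgian 2015, Lemma 3** (Bremner, *Lattice Basis Reduction*): a non-zero integer
combination `x = Σ aᵢbᵢ` of vectors `b₁, …, bₘ` satisfies `|x| ≥ |bₖ*|` for some `k` (namely the
largest `k` with `aₖ ≠ 0`: `⟪x, bₖ*⟫ = aₖ|bₖ*|²` and Cauchy–Schwarz), hence `|x|² ≥ min |bᵢ*|²`.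
Linear independence of the `bᵢ` is not needed. [cite: BestTrudgian2015, Lemma 3] -/
theorem exists_norm_gramSchmidt_le {m : ℕ} (b : Fin m → E) {a : Fin m → ℤ} (ha : a ≠ 0) :
    ∃ k, ‖gramSchmidt ℝ b k‖ ≤ ‖∑ i, (a i : ℝ) • b i‖ := by
  classical
  set s : Finset (Fin m) := Finset.univ.filter fun i ↦ a i ≠ 0 with hs
  have hsne : s.Nonempty := by
    obtain ⟨i, hi⟩ := Function.ne_iff.mp ha
    have hi : a i ≠ 0 := hi
    exact ⟨i, by simp [hs, hi]⟩
  set k := s.max' hsne with hk_def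
  have hk : a k ≠ 0 := (Finset.mem_filter.mp (s.max'_mem hsne)).2
  have hgt : ∀ i, k < i → a i = 0 := fun i hi ↦ by
    by_contra h
    exact absurd hi (not_lt.mpr (s.le_max' i (by simp [hs, h])))
  refine ⟨k, ?_⟩
  set x := ∑ i, (a i : ℝ) • b i with hx
  have hinner : ⟪gramSchmidt ℝ b k, x⟫_ℝ = a k * ‖gramSchmidt ℝ b k‖ ^ 2 := by
    rw [hx, inner_sum, Finset.sum_eq_single k]
    · rw [real_inner_smul_right, inner_gramSchmidt_self]
    · intro i _ hik
      rcases lt_or_gt_of_ne hik with h | h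
      · rw [real_inner_smul_right, gramSchmidt_inv_triangular ℝ b h, mul_zero]
      · rw [hgt i h, Int.cast_zero, zero_smul, inner_zero_right]
    · simp
  have hcs := abs_real_inner_le_norm (gramSchmidt ℝ b k) x
  rw [hinner, abs_mul, abs_of_nonneg (sq_nonneg ‖gramSchmidt ℝ b k‖)] at hcs
  have hak : (1 : ℝ) ≤ |(a k : ℝ)| := by exact_mod_cast Int.one_le_abs hk
  by_cases h0 : gramSchmidt ℝ b k = 0
  · rw [h0, norm_zero]
    exact norm_nonneg _
  · have hpos : 0 < ‖gramSchmidt ℝ b k‖ := norm_pos_iff.mpr h0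
    have h1 : ‖gramSchmidt ℝ b k‖ ^ 2 ≤ |(a k : ℝ)| * ‖gramSchmidt ℝ b k‖ ^ 2 :=
      le_mul_of_one_le_left (sq_nonneg _) hak
    have h2 : ‖gramSchmidt ℝ b k‖ * ‖gramSchmidt ℝ b k‖ ≤ ‖gramSchmidt ℝ b k‖ * ‖x‖ := by
      rw [← sq]; exact h1.trans hcs
    exact le_of_mul_le_mul_left h2 hpos

/-- Lemma 3 as used in Theorem 3: if every Gram–Schmidt vector of a family `b` generating a lattice
has `|bᵢ*|² ≥ B`, then every non-zero lattice vector has `|x|² ≥ B`. [cite: BestTrudgian2015, Lemma 3] -/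
theorem le_norm_sq_of_mem_span {m : ℕ} {b : Fin m → E} {B : ℝ}
    (hB : ∀ i, B ≤ ‖gramSchmidt ℝ b i‖ ^ 2) {v : E} (hv : v ∈ Submodule.span ℤ (Set.range b))
    (hv0 : v ≠ 0) : B ≤ ‖v‖ ^ 2 := by
  obtain ⟨a, rfl⟩ := (Submodule.mem_span_range_iff_exists_fun ℤ).mp hv
  have ha : a ≠ 0 := by
    rintro rfl
    simp at hv0
  obtain ⟨k, hk⟩ := exists_norm_gramSchmidt_le b ha
  have heq : ∑ i, (a i : ℝ) • b i = ∑ i, a i • b i :=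
    Finset.sum_congr rfl fun i _ ↦ Int.cast_smul_eq_zsmul ℝ (a i) (b i)
  rw [heq] at hk
  exact (hB k).trans (pow_le_pow_left₀ (norm_nonneg _) hk 2)

end GramSchmidt

/-! ## Theorem 3: the certificate -/

/-- **Best–Trudgian 2015, Theorem 3.** Let `Γ' = {γ₁, …, γₙ}` (distinct reals), `L₀ = L(K; Γ')`
and `L_t = L(K; Γ' ∪ {γ_t})` for `γ_t ∈ (Γ ∩ [0, T]) ∖ Γ'`, with bases `{b₁, …, bₙ}` and
`{β_{t,1}, …, β_{t,n}, β_{t,t}}` respectively. If `min |bᵢ*|² ≥ (n² + n)N_γ² + (2n + 2)N_γ + 2` and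
`min |β_{t,i}*|² ≥ (n² + n)N_γ² + 2nN_γ + 2` for all such `γ_t`, then the elements of `Γ'` are
`{N_γ}`-independent in `Γ ∩ [0, T]` (all `N_γ` equal). Proof as printed: (2.4) by Lemma 3 and the
contrapositive of Lemma 1; (2.5) with `γ* ∈ Γ'` by Lemma 1 again (the relation `c − e_{γ*}` is a
weak `N_γ`-dependence unless trivial), with `γ* ∉ Γ'` by Lemma 2. The bases need only generate the
lattices over `ℤ`. [cite: BestTrudgian2015, Theorem 3] -/
theorem nIndependent_of_gramSchmidt_bounds {K : ℤ} {N : ℕ} {γ : Fin n → ℝ}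
    (hγ : Function.Injective γ) {Γ : Set ℝ} {T : ℝ}
    (h₀ : ∃ b : Fin n → EuclideanSpace ℝ (Fin (n + 1)),
      lattice K γ ≤ Submodule.span ℤ (Set.range b) ∧
      ∀ i, ((n : ℝ) ^ 2 + n) * (N : ℝ) ^ 2 + (2 * n + 2) * N + 2 ≤ ‖gramSchmidt ℝ b i‖ ^ 2)
    (hₜ : ∀ γt ∈ Γ ∩ Set.Icc 0 T, γt ∉ Set.range γ →
      ∃ β : Fin (n + 1) → EuclideanSpace ℝ (Fin (n + 1 + 1)),
        lattice K (Fin.snoc γ γt : Fin (n + 1) → ℝ) ≤ Submodule.span ℤ (Set.range β) ∧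
        ∀ i, ((n : ℝ) ^ 2 + n) * (N : ℝ) ^ 2 + 2 * n * N + 2 ≤ ‖gramSchmidt ℝ β i‖ ^ 2) :
    NIndependent Γ T (Finset.univ.image γ) (fun _ ↦ N) := by
  classical
  obtain ⟨b, hb, hb'⟩ := h₀
  have hsumΓ : ∀ g : ℝ → ℝ, ∑ x ∈ Finset.univ.image γ, g x = ∑ i, g (γ i) := fun g ↦
    Finset.sum_image fun i _ j _ h ↦ hγ h
  have hmemΓ : ∀ x, x ∈ Finset.univ.image γ ↔ ∃ i, γ i = x := fun x ↦ by simp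
  -- no weak `N`-dependence among the `γᵢ` (Lemma 1 + Lemma 3 on `L₀`)
  have core : ∀ α : Fin n → ℤ, ∑ i, (α i : ℝ) * γ i = 0 → (∀ i, |α i| ≤ N + 1) →
      (∀ i j, |α i| = N + 1 → |α j| = N + 1 → i = j) → α = 0 := by
    intro α hrel hbd hone
    by_contra hα
    obtain ⟨v, hv, hv0, hvlt⟩ :=
      exists_short_of_weaklyNDependent (N := N) K ⟨α, hα, hrel, hbd, hone⟩
    exact absurd (le_norm_sq_of_mem_span hb' (hb hv) hv0) (not_le.mpr hvlt)
  refine ⟨fun c hc hsum x hx ↦ ?_, fun γs hγs c hc hsum ↦ ?_⟩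
  · obtain ⟨i₀, rfl⟩ := (hmemΓ x).mp hx
    have hrel : ∑ i, ((c (γ i) : ℤ) : ℝ) * γ i = 0 := by
      rw [← hsumΓ (fun x ↦ (c x : ℝ) * x)]
      exact hsum
    have hcN : ∀ i, |c (γ i)| ≤ N := fun i ↦ hc (γ i) ((hmemΓ _).mpr ⟨i, rfl⟩)
    have h0 := core (fun i ↦ c (γ i)) hrel (fun i ↦ (hcN i).trans (by simp)) fun i j hi _ ↦ by
      have := hcN i
      omega
    exact congrFun h0 i₀
  · by_cases hmem : γs ∈ Set.range γ
    · obtain ⟨i₀, rfl⟩ := hmem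
      have hcN : ∀ i, |c (γ i)| ≤ N := fun i ↦ hc (γ i) ((hmemΓ _).mpr ⟨i, rfl⟩)
      set α : Fin n → ℤ := fun i ↦ c (γ i) - if i = i₀ then 1 else 0 with hα
      have hrel : ∑ i, (α i : ℝ) * γ i = 0 := by
        have h1 : ∑ i, ((c (γ i) : ℤ) : ℝ) * γ i = γ i₀ := by
          rw [← hsumΓ (fun x ↦ (c x : ℝ) * x)]
          exact hsum
        have h2 : ∑ i, ((if i = i₀ then (1 : ℤ) else 0 : ℤ) : ℝ) * γ i = γ i₀ := by
          simp [Finset.sum_ite_eq']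
        simp only [hα, Int.cast_sub, sub_mul, Finset.sum_sub_distrib, h1, h2, sub_self]
      have hαi : ∀ i, i ≠ i₀ → α i = c (γ i) := fun i hi ↦ by simp [hα, hi]
      have hα0 : α i₀ = c (γ i₀) - 1 := by simp [hα]
      have hbd : ∀ i, |α i| ≤ N + 1 := fun i ↦ by
        by_cases hi : i = i₀
        · subst hi
          rw [hα0]
          have := hcN i
          rw [abs_le] at this ⊢
          omega
        · rw [hαi i hi]
          exact (hcN i).trans (by simp)
      have hone : ∀ i j, |α i| = N + 1 → |α j| = N + 1 → i = j := by
        have key : ∀ i, |α i| = N + 1 → i = i₀ := fun i hi ↦ by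
          by_contra hne
          rw [hαi i hne] at hi
          have := hcN i
          omega
        intro i j hi hj
        rw [key i hi, key j hj]
      have h0 := core α hrel hbd hone
      refine ⟨(hmemΓ _).mpr ⟨i₀, rfl⟩, ?_, fun x hx hne ↦ ?_⟩
      · have := congrFun h0 i₀
        rw [Pi.zero_apply, hα0] at this
        omega
      · obtain ⟨i, rfl⟩ := (hmemΓ x).mp hx
        have hi : i ≠ i₀ := fun h ↦ hne (by rw [h])
        have := congrFun h0 i
        rwa [Pi.zero_apply, hαi i hi] at this
    · exfalso
      obtain ⟨β, hβ, hβ'⟩ := hₜ γs hγs hmem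
      have hcN : ∀ i, |c (γ i)| ≤ N := fun i ↦ hc (γ i) ((hmemΓ _).mpr ⟨i, rfl⟩)
      have hrel : ∑ i, ((c (γ i) : ℤ) : ℝ) * γ i = γs := by
        rw [← hsumΓ (fun x ↦ (c x : ℝ) * x)]
        exact hsum
      obtain ⟨v, hv, hv0, hvlt⟩ := exists_short_of_relation (N := N) K hcN hrel
      exact absurd (le_norm_sq_of_mem_span hβ' (hβ hv) hv0) (not_le.mpr hvlt)

end BestTrudgian

end Literature.NumberTheory.LFunctions

end
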